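import Summits.QuantumFields.YangMills.Theorems.FemtoCutoffLadderTowerTelescoping
import Summits.QuantumFields.YangMills.Theorems.FemtoCutoffLadderCoarsePairScalingGlue

/-!
# Route `FemtoCutoffLadder` (QuantumFields / YangMills; rung R2b1 leaf `FemtoGapOfRecord`) — the rev-9 Assembly item `Assembly2`
# (stmt-QuantumFields-24086), PROVED; the route is exactly {`OctaveStepDecay` (tower, R1), `SubOctaveBounded`, tree leaf `FemtoGapFixedLattice`}

Lead seat `ym-line-fcl-p1` (2026-08-28).  `Assembly2 : OctaveStepDecay → SubOctaveBounded → CoarsePairScaling → OneSiteWindowAnchor →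
MatchedCouplingExists → FemtoGapOfRecord`, with the rev-9 TOWER form of the nested step (only `L' = L₀·2^i`) carrying the telescoping
asymptotic-scaling allowance `D(1/β' − 1/β)` (the lead's repair R1 of the matched-two-loop-label defect; three-loop scaling `q(SU(2)) = +0.08324`
[cite: AllesFeoPanagopoulos1997, eq. (3.7)]; evidence `Cruxes/UniformStepScaling/Misstated.md`), is an instance of the route-independent tower
ladder `CutoffLadder.femtoGapOfRecord_of_towerLadder` (`FemtoCutoffLadderTowerTelescoping.lean`).

* ★ `assembly2_proof : Theses.FemtoCutoffLadder.Assembly2` (the item, by name);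
* `femtoGapOfRecord_of_steps_of_fixedLattice : OctaveStepDecay → SubOctaveBounded → FemtoGapFixedLattice → FemtoGapOfRecord` — with the closed
  glue (23945), one-site upper (23944), anchor (23508) and matching (23770): **the route stands on exactly its two step cruxes and the tree's
  fixed-lattice leaf.**

HONEST FRAMING: bookkeeping; none of the three remaining obligations is proved here (the two steps sit behind `UVStabilityNonUniqueness`, the
fixed-lattice leaf is open for `L ≥ 2`).  R2b1 is a RECORD rung — not infinite volume, not a mass gap, not Clay; no summit is proved by this line.
No definitions, no named facts, no `sorry`.
-/

set_option autoImplicit false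

noncomputable section

namespace Summit.QuantumFields.YangMills.Theorems.FemtoCutoffLadder

open Real
open Summit.QuantumFields.YangMills.Theorems.FemtoTransferGap
open Summit.QuantumFields.YangMills.Theses.FemtoCutoffLadder

/-- ★ **`Assembly2` (stmt-QuantumFields-24086), PROVED**: `OctaveStepDecay → SubOctaveBounded → CoarsePairScaling → OneSiteWindowAnchor →
MatchedCouplingExists → FemtoGapOfRecord` (rev 9: tower-form nested step with the R1 allowance) — by the route-independent tower ladder
`CutoffLadder.femtoGapOfRecord_of_towerLadder` (one bounded incommensurable step onto the tower `L₀·2^{L₀'+j}`, the nested chain down the tower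
with summable defects and telescoping allowance, the coarse pair at the tower base, the one-site anchor; `L`-th roots by positivity).
[cite: LuscherWeiszWolff1991] [cite: AllesFeoPanagopoulos1997, eq. (3.7)] -/
theorem assembly2_proof : Summit.QuantumFields.YangMills.Theses.FemtoCutoffLadder.Assembly2 := by
  intro h₁ h₂ h₃ h₄ h₅
  refine CutoffLadder.femtoGapOfRecord_of_towerLadder h₁ h₂ ?_ h₄ h₅
  intro L _
  obtain ⟨C, lam0, hlam0, H⟩ := h₃ L
  refine ⟨C, lam0, hlam0, fun lam hlam hle β β' hW hW' hm => ?_⟩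
  simpa only [pow_one] using H lam hlam hle β β' hW hW' hm

/-- ★★ **The route is exactly {`OctaveStepDecay`, `SubOctaveBounded`, tree leaf `FemtoGapFixedLattice`}:** the two steps and the fixed-lattice
leaf give `FemtoGapOfRecord` — coarse pairs from the leaf (`coarsePairScaling_of_fixedLattice`: glue stmt-23945 + one-site upper stmt-23944,
closed), anchor (stmt-23508, closed), matching (stmt-23770, closed), telescoping (`assembly2_proof`). [cite: LuscherWeiszWolff1991] [cite: Luscher1983, §2] -/
theorem femtoGapOfRecord_of_steps_of_fixedLattice (h₁ : OctaveStepDecay) (h₂ : SubOctaveBounded) (hFL : FemtoGapFixedLattice) :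
    FemtoGapOfRecord :=
  assembly2_proof h₁ h₂ (coarsePairScaling_of_fixedLattice hFL) oneSiteWindowAnchor_proof matchedCouplingExists_proof

end Summit.QuantumFields.YangMills.Theorems.FemtoCutoffLadder

end

-- build re-dispatch 2026-08-28 (ops-buildfix-2 gen 27, W1): comment-only touch so that the lane builds this module, whose only 4 attempts
-- (00:55–01:18Z) died rc 76 behind the since-repaired import `FemtoCutoffLadderAssembly` (p598720); no declaration changed.
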